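import Summits.AtomisticToContinuum.Crystallization.Theorems.ThreeConeCertificateSlackRigidityPricedFloorsLayerEnergy
import HarnessLib

/-!
# `SlackRigidity` (stmt-AtomisticToContinuum-11960), line `priced-floors-palm-exactification`, stub S3
# (`stub_layeredMeanSelection`), fault identification package (FI4): the fault price in the consumed shape

Lead c19, worker W14.  The symmetric fault price `SlackRigidityPricedFloorsLayerEnergy.lms_fault_price_symmetric`
(`c₀ · faultE ≤ 2 · (2h − HcE)`) in the shape consumed by the mean fault-exclusion argument
`SlackRigidityPricedFloorsFaults.lms_faults_ae_zero` (`c · F ≤ 2h − Hc`, with `c = c₀ / 2`):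
for data `e` fitting `S`,

  `c · (1[s 1 ≠ −s 0] + 1[s(−2) ≠ −s(−1)]) ≤ 2 h(count|S) − (Φ₀(a) + Σ'_{m ≠ 0} Φ(a, z m, L_alt m))`.

Registered sub-goal `lms_fault_price_ae_form`.  `[folklore]` bookkeeping.
-/

noncomputable section

open MeasureTheory Filter Set
open scoped ENNReal BigOperators Topology

namespace Summit.AtomisticToContinuum.Crystallization.Theorems.SlackRigidityPricedFloorsFaultIdent

open Literature.Probability.Process
open Literature.MathematicalPhysics.StatisticalMechanics
open Summit.AtomisticToContinuum.Crystallization.Theorems.SlackRigidityPricedFloors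
open Summit.AtomisticToContinuum.Crystallization.Theorems.SlackRigidityPricedFloorsLayerEnergy

/-- **The fault price, consumed shape** (registered sub-goal `lms_fault_price_ae_form`): there is `c > 0`
such that for all data `e` fitting `S`, `c · faultE e ≤ 2 h(count|S) − HcE e`. [folklore] -/
theorem lms_fault_price_ae_form : ∃ c : ℝ, 0 < c ∧ ∀ (S : Set E3) (e : LData), Fits S e → c * ((if e.2.2.1 1 = -e.2.2.1 0 then (0 : ℝ) else 1) + (if e.2.2.1 (-2) = -e.2.2.1 (-1) then (0 : ℝ) else 1)) ≤ 2 * rootEnergy lennardJones ((Measure.count : Measure E3).restrict S) - (inLayerInteraction lennardJones e.2.1 + ∑' m : ℤ, if m = 0 then (0 : ℝ) else layerInteraction lennardJones e.2.1 (e.2.2.2 m) (haggLabel alternatingHagg m) 1) := by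
  obtain ⟨c₀, hc₀, hp⟩ := lms_fault_price_symmetric
  refine ⟨c₀ / 2, half_pos hc₀, fun S e he => ?_⟩
  have h := hp S e he
  linarith

end Summit.AtomisticToContinuum.Crystallization.Theorems.SlackRigidityPricedFloorsFaultIdent

end
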